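import Mathlib
import Literature.Computability.AlgebraicComplexity.DeterminantalConormalBoundPlane

/-!
# ValiantsHypothesis / RigidityForcesSymmetry — crux `LaplaceOptimalFive` (stmt-ValiantsHypothesis-24813), crux idea
`young-shadow` (K1) on the star: **LEMMA K, STEP 1 — THE DENOMINATOR TRICHOTOMY** (memo `NOTE-p4g15-24813-K1-star.md` §14 (c2),
referee note `NOTE-crit3g5-24813-Lemma2prime-elementary.md` §B (c2))

Setting of the referee's LEMMA K: three families of polynomials `k, p, q : ι → R`, `R = K[y]` a polynomial ring over a field
(`p, q` the gradients of two quadrics — linear forms —, `k` the gradient of a cubic; here `k` may be arbitrary), such that every `3 × 3` minor of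
the matrix `[k | p | q]` vanishes (`dk ∧ dq₁ ∧ dq₂ = 0`, ✓ `wedge_minors_poly`), and one `2 × 2` minor
`M₀ = M_{a₀c₀}`, `M_{ac} := p_a q_c − p_c q_a`, is non-zero.  By Cramer (✓ `cramer_consistency`) `k = α p + β q` with the RATIONAL
functions `α = N₀/M₀`, `β = N₀'/M₀`.  The paper controls the denominator by a dimension count («`dim Σ ≤ 3`»); here we replace it by
UNIQUE FACTORISATION of the single quadric `M₀` (at most two prime factors, each a linear form or `M₀` itself), which gives the

**Denominator trichotomy** (`denominator_trichotomy`): EITHER (I) `α, β` are POLYNOMIALS (`k_u = α p_u + β q_u` in `R`), OR (II) every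
minor `M_{ac}` is a scalar multiple of `M₀`, OR (III) some non-zero linear form divides every minor `M_{ac}`.

(The three exits are closed elsewhere: (I) by the Hessian-symmetry endgame, (II) ⟹ binary pencil, (III) ⟹ square member / binary /
common factor.)  Also recorded: the Cramer identity `M₀ k_u = N₀ p_u + N₀' q_u` and the two divisibilities `M₀ ∣ N₀ M_{bd}`,
`M₀ ∣ N₀' M_{bd}` it rests on.

Pure commutative algebra (Mathlib's UFD structure on `MvPolynomial`, `totalDegree_mul_of_isDomain`, and the tree's
✓ `isHomogeneous_of_dvd_isHomogeneous`); no star hypotheses, no definitions, no `sorry`.  Honest framing: helper toward the Lean price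
(L2) of the K1-on-the-star theorem (PAPER, referee PASS; not kernel); `LaplaceOptimalFive` OPEN · CONTESTED 72/120; `VP ≠ VNP` NOT proved.
-/

set_option linter.dupNamespace false

namespace Summit.ValiantsHypothesis.ValiantsHypothesis.Theorems.RigidityForcesSymmetryRankRigidMinimalRepr

namespace LaplaceFiveStar

open MvPolynomial

/-- **Cramer's identity.**  If all `3 × 3` minors of `[k | p | q]` vanish then, for every pair `(a₀, c₀)` and every row `u`,
`M_{a₀c₀} · k_u = N_{a₀c₀} · p_u + N'_{a₀c₀} · q_u` with `M = p ∧ q`, `N = k ∧ q`, `N' = p ∧ k` (any commutative ring). [folklore] -/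
theorem cramer_identity {R : Type*} [CommRing R] {ι : Type*} (k p q : ι → R)
    (hT : ∀ u v w : ι, k u * (p v * q w - p w * q v) - k v * (p u * q w - p w * q u) + k w * (p u * q v - p v * q u) = 0)
    (a₀ c₀ u : ι) :
    (p a₀ * q c₀ - p c₀ * q a₀) * k u
      = (k a₀ * q c₀ - k c₀ * q a₀) * p u + (p a₀ * k c₀ - p c₀ * k a₀) * q u := by
  linear_combination hT u a₀ c₀

/-- Consistency for the first numerator: `M_{a₀c₀} ∣ N_{a₀c₀} · M_{bd}` (witness `N_{bd}`; ✓ `cramer_consistency`). [folklore] -/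
theorem minor_dvd_numerator_mul {R : Type*} [CommRing R] {ι : Type*} (k p q : ι → R)
    (hT : ∀ u v w : ι, k u * (p v * q w - p w * q v) - k v * (p u * q w - p w * q u) + k w * (p u * q v - p v * q u) = 0)
    (a₀ c₀ b d : ι) :
    (p a₀ * q c₀ - p c₀ * q a₀) ∣ (k a₀ * q c₀ - k c₀ * q a₀) * (p b * q d - p d * q b) := by
  refine ⟨k b * q d - k d * q b, ?_⟩
  linear_combination q c₀ * hT a₀ b d + q a₀ * hT c₀ d b

/-- Consistency for the second numerator: `M_{a₀c₀} ∣ N'_{a₀c₀} · M_{bd}` (witness `N'_{bd}`). [folklore] -/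
theorem minor_dvd_numerator'_mul {R : Type*} [CommRing R] {ι : Type*} (k p q : ι → R)
    (hT : ∀ u v w : ι, k u * (p v * q w - p w * q v) - k v * (p u * q w - p w * q u) + k w * (p u * q v - p v * q u) = 0)
    (a₀ c₀ b d : ι) :
    (p a₀ * q c₀ - p c₀ * q a₀) ∣ (p a₀ * k c₀ - p c₀ * k a₀) * (p b * q d - p d * q b) := by
  refine ⟨p b * k d - p d * k b, ?_⟩
  linear_combination -(p c₀ * hT a₀ b d) - p a₀ * hT c₀ d b

/-- A non-zero polynomial of total degree `1` over a field is prime. [folklore] -/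
theorem prime_of_totalDegree_eq_one {K : Type*} [Field K] {σ : Type*} {r : MvPolynomial σ K}
    (hr : r.totalDegree = 1) : Prime r := by
  classical
  have hr0 : r ≠ 0 := by
    rintro rfl
    simp at hr
  refine UniqueFactorizationMonoid.irreducible_iff_prime.mp (irreducible_of_totalDegree_eq_one hr fun x hx => ?_)
  obtain ⟨i, hi⟩ : ∃ i, r.coeff i ≠ 0 := by
    by_contra h
    simp only [not_exists, not_not] at h
    exact hr0 (MvPolynomial.ext _ _ (by simpa using h))
  have hx0 : x ≠ 0 := by
    rintro rfl
    exact hi (zero_dvd_iff.mp (hx i))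
  exact isUnit_iff_ne_zero.mpr hx0

/-- A polynomial over a field of total degree `0` which is non-zero is a unit. [folklore] -/
theorem isUnit_of_totalDegree_eq_zero {K : Type*} [Field K] {σ : Type*} {r : MvPolynomial σ K}
    (hr : r.totalDegree = 0) (hr0 : r ≠ 0) : IsUnit r := by
  rw [totalDegree_eq_zero_iff_eq_C] at hr
  rw [hr]
  refine (isUnit_iff_ne_zero.mpr fun h => hr0 ?_).map C
  rw [hr, h, C_0]

/-- **LEMMA K, step 1 — the denominator trichotomy.**  `R = K[y]` (`K` a field), `p_a, q_a` linear forms, `k_a` ARBITRARY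
polynomials with all `3 × 3` minors of `[k | p | q]` zero and `M₀ = p_{a₀} q_{c₀} − p_{c₀} q_{a₀} ≠ 0.  Then (I) `k = α p + β q` with POLYNOMIAL
`α, β`, or (II) every minor `M_{ac}` is a scalar multiple of `M₀`, or (III) a non-zero linear form divides every minor.
Proof: unique factorisation of the quadric `M₀ = π · r` (`π` prime of degree `1` or `2`) against `M₀ ∣ N₀ M_{bd}`,
`M₀ ∣ N₀' M_{bd}`. [folklore] -/
theorem denominator_trichotomy {K : Type*} [Field K] {σ ι : Type*} (k p q : ι → MvPolynomial σ K)
    (hp : ∀ a, (p a).IsHomogeneous 1) (hq : ∀ a, (q a).IsHomogeneous 1)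
    (hT : ∀ u v w : ι, k u * (p v * q w - p w * q v) - k v * (p u * q w - p w * q u) + k w * (p u * q v - p v * q u) = 0)
    (a₀ c₀ : ι) (h0 : p a₀ * q c₀ - p c₀ * q a₀ ≠ 0) :
    (∃ α β : MvPolynomial σ K, ∀ u, k u = α * p u + β * q u) ∨
    (∀ a c, ∃ t : K, p a * q c - p c * q a = C t * (p a₀ * q c₀ - p c₀ * q a₀)) ∨
    (∃ L : MvPolynomial σ K, L.IsHomogeneous 1 ∧ L ≠ 0 ∧ ∀ a c, L ∣ p a * q c - p c * q a) := by
  classical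
  set M₀ := p a₀ * q c₀ - p c₀ * q a₀ with hM₀
  set N₀ := k a₀ * q c₀ - k c₀ * q a₀ with hN₀
  set N₀' := p a₀ * k c₀ - p c₀ * k a₀ with hN₀'
  -- homogeneity and degree of `M₀`
  have hMh : ∀ a c, (p a * q c - p c * q a).IsHomogeneous 2 := fun a c =>
    ((hp a).mul (hq c)).sub ((hp c).mul (hq a))
  have hM₀h : M₀.IsHomogeneous 2 := hMh a₀ c₀
  have hdegM₀ : M₀.totalDegree = 2 := hM₀h.totalDegree h0
  -- Cramer and the two consistencies
  have cramer : ∀ u, M₀ * k u = N₀ * p u + N₀' * q u := fun u => cramer_identity k p q hT a₀ c₀ u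
  have cons1 : ∀ b d, M₀ ∣ N₀ * (p b * q d - p d * q b) := fun b d => minor_dvd_numerator_mul k p q hT a₀ c₀ b d
  have cons2 : ∀ b d, M₀ ∣ N₀' * (p b * q d - p d * q b) := fun b d => minor_dvd_numerator'_mul k p q hT a₀ c₀ b d
  -- the three exits
  have exitI : M₀ ∣ N₀ → M₀ ∣ N₀' →
      (∃ α β : MvPolynomial σ K, ∀ u, k u = α * p u + β * q u) := by
    rintro ⟨α, hα⟩ ⟨β, hβ⟩
    refine ⟨α, β, fun u => mul_left_cancel₀ h0 ?_⟩
    rw [cramer u, hα, hβ]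
    ring
  have exitII : (∀ b d, M₀ ∣ p b * q d - p d * q b) →
      (∀ a c, ∃ t : K, p a * q c - p c * q a = C t * (p a₀ * q c₀ - p c₀ * q a₀)) := by
    intro hall a c
    obtain ⟨s, hs⟩ := hall a c
    by_cases hac : p a * q c - p c * q a = 0
    · exact ⟨0, by rw [hac, C_0, zero_mul]⟩
    · have hs0 : s ≠ 0 := by
        rintro rfl
        exact hac (by rw [hs, mul_zero])
      have hdeg : (p a * q c - p c * q a).totalDegree = M₀.totalDegree + s.totalDegree := by
        rw [hs, totalDegree_mul_of_isDomain h0 hs0]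
      rw [(hMh a c).totalDegree hac, hdegM₀] at hdeg
      have hs' : s.totalDegree = 0 := by omega
      rw [totalDegree_eq_zero_iff_eq_C] at hs'
      obtain ⟨t, ht⟩ : ∃ t : K, s = C t := ⟨coeff 0 s, hs'⟩
      exact ⟨t, by rw [hs, ht]; ring⟩
  have generic : ∀ {ϖ X : MvPolynomial σ K}, Prime ϖ → (∀ b d, ϖ ∣ X * (p b * q d - p d * q b)) →
      (∀ b d, ϖ ∣ p b * q d - p d * q b) ∨ ϖ ∣ X := by
    intro ϖ X hϖ h
    by_cases hall : ∀ b d, ϖ ∣ p b * q d - p d * q b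
    · exact Or.inl hall
    · simp only [not_forall] at hall
      obtain ⟨b, d, hbd⟩ := hall
      exact Or.inr ((hϖ.dvd_or_dvd (h b d)).resolve_right hbd)
  -- a prime factor of `M₀`
  have hnu : ¬ IsUnit M₀ := fun hu => by
    have := (isUnit_iff_totalDegree_of_isReduced.mp hu).2
    omega
  obtain ⟨π, hπirr, r, hr⟩ := WfDvdMonoid.exists_irreducible_factor hnu h0
  have hπ : Prime π := UniqueFactorizationMonoid.irreducible_iff_prime.mp hπirr
  have hπ0 : π ≠ 0 := hπ.ne_zero
  have hr0 : r ≠ 0 := by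
    rintro rfl
    exact h0 (by rw [hr, mul_zero])
  have hdeg : π.totalDegree + r.totalDegree = 2 := by
    rw [← hdegM₀, hr, totalDegree_mul_of_isDomain hπ0 hr0]
  have hπdeg : π.totalDegree ≠ 0 := fun h =>
    hπirr.not_isUnit (isUnit_of_totalDegree_eq_zero h hπ0)
  have hπM₀ : π ∣ M₀ := ⟨r, hr⟩
  have hrM₀ : r ∣ M₀ := ⟨π, by rw [hr, mul_comm]⟩
  -- homogeneity of the factors (divisors of the non-zero form `M₀`)
  have hπh : π.IsHomogeneous π.totalDegree :=
    Literature.Computability.AlgebraicComplexity.DeterminantalConormal.isHomogeneous_of_dvd_isHomogeneous hM₀h h0 hπM₀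
  have hrh : r.IsHomogeneous r.totalDegree :=
    Literature.Computability.AlgebraicComplexity.DeterminantalConormal.isHomogeneous_of_dvd_isHomogeneous hM₀h h0 hrM₀
  have h1 : ∀ b d, π ∣ N₀ * (p b * q d - p d * q b) := fun b d => dvd_trans hπM₀ (cons1 b d)
  have h2 : ∀ b d, π ∣ N₀' * (p b * q d - p d * q b) := fun b d => dvd_trans hπM₀ (cons2 b d)
  by_cases hπ2 : π.totalDegree = 2
  · -- `M₀ = π · unit`
    have hrdeg : r.totalDegree = 0 := by omega
    have hru : IsUnit r := isUnit_of_totalDegree_eq_zero hrdeg hr0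
    have hM₀π : M₀ ∣ π := by
      obtain ⟨v, hv⟩ := hru
      refine ⟨↑v⁻¹, ?_⟩
      rw [hr, ← hv, mul_assoc, Units.mul_inv, mul_one]
    rcases generic hπ h1 with hall | hN
    · exact Or.inr (Or.inl (exitII fun b d => dvd_trans hM₀π (hall b d)))
    rcases generic hπ h2 with hall | hN'
    · exact Or.inr (Or.inl (exitII fun b d => dvd_trans hM₀π (hall b d)))
    exact Or.inl (exitI (dvd_trans hM₀π hN) (dvd_trans hM₀π hN'))
  · -- `π` and `r` are both linear forms
    have hπ1 : π.totalDegree = 1 := by omega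
    have hr1 : r.totalDegree = 1 := by omega
    have hrp : Prime r := prime_of_totalDegree_eq_one hr1
    rcases generic hπ h1 with hall | hN
    · exact Or.inr (Or.inr ⟨π, hπ1 ▸ hπh, hπ0, hall⟩)
    rcases generic hπ h2 with hall | hN'
    · exact Or.inr (Or.inr ⟨π, hπ1 ▸ hπh, hπ0, hall⟩)
    obtain ⟨N₁, hN₁⟩ := hN
    obtain ⟨N₁', hN₁'⟩ := hN'
    have h1' : ∀ b d, r ∣ N₁ * (p b * q d - p d * q b) := fun b d => by
      have h := cons1 b d
      rw [hr, hN₁, mul_assoc] at h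
      exact (mul_dvd_mul_iff_left hπ0).mp h
    have h2' : ∀ b d, r ∣ N₁' * (p b * q d - p d * q b) := fun b d => by
      have h := cons2 b d
      rw [hr, hN₁', mul_assoc] at h
      exact (mul_dvd_mul_iff_left hπ0).mp h
    rcases generic hrp h1' with hall | hM
    · exact Or.inr (Or.inr ⟨r, hr1 ▸ hrh, hr0, hall⟩)
    rcases generic hrp h2' with hall | hM'
    · exact Or.inr (Or.inr ⟨r, hr1 ▸ hrh, hr0, hall⟩)
    obtain ⟨α, hα⟩ := hM
    obtain ⟨β, hβ⟩ := hM'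
    refine Or.inl (exitI ⟨α, ?_⟩ ⟨β, ?_⟩)
    · rw [hN₁, hα, hr, mul_assoc]
    · rw [hN₁', hβ, hr, mul_assoc]

end LaplaceFiveStar

end Summit.ValiantsHypothesis.ValiantsHypothesis.Theorems.RigidityForcesSymmetryRankRigidMinimalRepr
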